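import Summits.KontsevichZagierPeriods.KontsevichZagierPeriods.Theorems.HurwitzMicroSectorsNormalFormPrincipleLevelOne
import Summits.KontsevichZagierPeriods.KontsevichZagierPeriods.Theorems.HurwitzMicroSectorsNormalFormPrincipleSlabASubPtK20
import Summits.KontsevichZagierPeriods.KontsevichZagierPeriods.Theorems.HurwitzMicroSectorsNormalFormPrincipleAlgCarriers
import Summits.KontsevichZagierPeriods.KontsevichZagierPeriods.Theorems.HurwitzMicroSectorsNormalFormPrincipleM2FiveZetaTwo

/-!
# `NormalFormPrinciple` (stmt-KontsevichZagierPeriods-3869), line `SketchIdeator1` — leaf `stub_boxRigidity`: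
# level two with real-algebraic coefficients: the merge gadget and the coordinate swap (rule 2)

Registered sub-goal `levelTwo_merge_and_swap` of the layer "Conjecture 1 for
`[(0,1)², P(x,y)/(1 − x²y²)]` with `P ∈ (ℚ̄ ∩ ℝ)[x,y]`" (lead file `…AlgLevelTwo`): the two rule-2
moves of the algebraic level-one layer (`…AlgMergeAndSwap`), ported from the kernel `1/(1 − xy)`
to the kernel `1/(1 − x²y²)`.

1. The MERGE GADGET `(x₀,x₁) ↦ (x₀, x₀x₁)`: for `b < a` and `c` real algebraic, the box
   representation `N = [(0,1)², c x₀^a x₁^b/(1 − x₀²x₁²)]` and the triangle representation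
   `R = [T, c z₀^{a−b−1} z₁^b/(1 − z₁²)]`, `T = {0 < z₀ < 1, 0 ≤ z₁ ≤ z₀}`, differ by a relation:
   `N` is congruent (rule 1, two null edges `x₁ ∈ {0,1}`) to the same integrand on the band-box
   `{0 < x₀ < 1, 0 ≤ x₁ ≤ 1}`, which the substitution `z₁ = x₀x₁` along the last coordinate
   (`KZ.of_sub_of_mem_relations_of_affine`, `α = 0`, `β = x₀`, Jacobian `x₀`) carries onto `T`,
   with `c x₀^{a−b−1}(x₀x₁)^b/(1 − (x₀x₁)²) · x₀ = c x₀^a x₁^b/(1 − x₀²x₁²)`. The integrand is the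
   product of the `ℚ`-semialgebraic constant `c` (`isSemialgebraicFunOn_const_of_isAlgebraic`) and
   the rational function `x₀^a x₁^b/(1 − x₀²x₁²)`, whose denominator is positive on the band-box.
2. The COORDINATE SWAP `x₀ ↔ x₁`:
   `[(0,1)², c x₀^a x₁^b/(1 − x₀²x₁²)] ≡ [(0,1)², c x₀^b x₁^a/(1 − x₀²x₁²)]`
   (`KZ.of_sub_of_reindex_mem_relations` with `Equiv.swap 0 1`, then congruence of integrands; the
   kernel is swap-invariant).

References: M. Kontsevich, D. Zagier, *Periods* (2001), §1.2 rules (1), (2). No new definitions.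
-/

noncomputable section

open MeasureTheory Set
open Literature.NumberTheory.Transcendental Literature.NumberTheory.Transcendental.KZ
open Literature.ModelTheory.ExponentialFields (IsSemialgebraic)

namespace Summit.KontsevichZagierPeriods.HurwitzMicroSectors.NormalFormPrinciple.PiBox.AlgLevelTwo

open Summit.KontsevichZagierPeriods.HurwitzMicroSectors.NormalFormPrinciple.PiBox.LevelOne
  (merge_snoc_init_apply_zero merge_snoc_init_apply_one)

/-- The level-two merge identity
`c x^a t^b/(1 − x² t²) = c x^{a−b−1} (x t)^b/(1 − (x t)²) · x` for `b < a`
(`a = (a − b − 1) + b + 1`). [folklore] -/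
theorem lt2_merge_identity {a b : ℕ} (hab : b < a) (c x t : ℝ) :
    c * (x ^ a * t ^ b) / (1 - x ^ 2 * t ^ 2) =
      c * (x ^ (a - b - 1) * (x * t) ^ b) / (1 - (x * t) ^ 2) * x := by
  obtain ⟨k, rfl⟩ : ∃ k, a = b + 1 + k := ⟨a - (b + 1), by omega⟩
  have hk : b + 1 + k - b - 1 = k := by omega
  rw [hk, mul_pow x t 2]
  ring

/-- The level-two merge identity at a point `z` of the band-box, the substituted point being
`(z₀, z₀ z₁) = Fin.snoc (Fin.init z) (0 + z₀ z₁)` (the shape produced by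
`KZ.of_sub_of_mem_relations_of_affine` with `α = 0`, `β = z₀`). [folklore] -/
theorem lt2_merge_identity_snoc {a b : ℕ} (hab : b < a) (c : ℝ) (z : Fin 2 → ℝ) :
    c * (z 0 ^ a * z 1 ^ b) / (1 - z 0 ^ 2 * z 1 ^ 2) =
      c * ((Fin.snoc (Fin.init z) (0 + Fin.init z 0 * z (Fin.last 1)) : Fin 2 → ℝ) 0 ^ (a - b - 1) *
          (Fin.snoc (Fin.init z) (0 + Fin.init z 0 * z (Fin.last 1)) : Fin 2 → ℝ) 1 ^ b) /
        (1 - (Fin.snoc (Fin.init z) (0 + Fin.init z 0 * z (Fin.last 1)) : Fin 2 → ℝ) 1 ^ 2) *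
        Fin.init z 0 := by
  have hi : Fin.init z 0 = z 0 := rfl
  have hl : z (Fin.last 1) = z 1 := rfl
  rw [merge_snoc_init_apply_zero z, merge_snoc_init_apply_one z, hi, hl, zero_add]
  exact lt2_merge_identity hab c (z 0) (z 1)

/-- On the band-box `{0 < x₀ < 1, 0 ≤ x₁ ≤ 1}` the level-two denominator is positive:
`0 < 1 − x₀² x₁²` (since `0 ≤ x₀x₁ < 1`). [folklore] -/
theorem lt2_denom_pos {x : Fin 2 → ℝ} (h : (0 < x 0 ∧ x 0 < 1) ∧ 0 ≤ x 1 ∧ x 1 ≤ 1) :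
    0 < 1 - x 0 ^ 2 * x 1 ^ 2 := by
  have hp : 0 ≤ x 0 * x 1 := mul_nonneg h.1.1.le h.2.1
  have h01 : x 0 * x 1 ≤ x 0 * 1 := mul_le_mul_of_nonneg_left h.2.2 h.1.1.le
  have hlt : x 0 * x 1 < 1 := by linarith [h.1.2]
  have hsq : x 0 ^ 2 * x 1 ^ 2 = (x 0 * x 1) * (x 0 * x 1) := by ring
  rw [hsq]
  nlinarith [mul_nonneg hp (sub_nonneg.2 hlt.le)]

/-- The integrand `c x₀^a x₁^b/(1 − x₀²x₁²)` with a real-algebraic coefficient `c` is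
`ℚ`-semialgebraic on the band-box `{0 < x₀ < 1, 0 ≤ x₁ ≤ 1}` (where `1 − x₀²x₁² > 0`): it is the
product of the `ℚ`-definable constant `c` and a quotient of polynomials over `ℚ`.
[cite: KontsevichZagier2001, §1.1] -/
theorem lt2_isSemialgebraicFunOn_alg_monomial_div (a b : ℕ) {c : ℝ} (hc : IsAlgebraic ℚ c)
    (hB : IsSemialgebraic ℚ
      (KZlog.band {y : Fin 1 → ℝ | 0 < y 0 ∧ y 0 < 1} (fun _ => (0:ℝ)) (fun _ => (1:ℝ)))) :
    IsSemialgebraicFunOn ℚ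
      (KZlog.band {y : Fin 1 → ℝ | 0 < y 0 ∧ y 0 < 1} (fun _ => (0:ℝ)) (fun _ => (1:ℝ)))
      (fun x => c * (x 0 ^ a * x 1 ^ b) / (1 - x 0 ^ 2 * x 1 ^ 2)) := by
  have hq : ∀ x ∈ KZlog.band {y : Fin 1 → ℝ | 0 < y 0 ∧ y 0 < 1} (fun _ => (0:ℝ)) (fun _ => (1:ℝ)),
      MvPolynomial.aeval x
        (1 - MvPolynomial.X 0 ^ 2 * MvPolynomial.X 1 ^ 2 : MvPolynomial (Fin 2) ℚ) ≠ 0 := by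
    intro x hx
    have h : (0 < x 0 ∧ x 0 < 1) ∧ 0 ≤ x 1 ∧ x 1 ≤ 1 := hx
    simp only [map_sub, map_mul, map_one, map_pow, MvPolynomial.aeval_X]
    exact (lt2_denom_pos h).ne'
  refine (IsSemialgebraicFunOn.mul_holds (isSemialgebraicFunOn_const_of_isAlgebraic hB hc)
    (isSemialgebraicFunOn_aeval_div_aeval hB (MvPolynomial.X 0 ^ a * MvPolynomial.X 1 ^ b)
      (1 - MvPolynomial.X 0 ^ 2 * MvPolynomial.X 1 ^ 2) hq)).congr fun x _ => ?_
  simp only [Pi.mul_apply, map_sub, map_mul, map_one, map_pow, MvPolynomial.aeval_X]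
  ring

/-- **The level-two merge gadget with a real-algebraic coefficient** (Kontsevich–Zagier rule 2).
For `b < a` and `c` real algebraic, the box representation `N = [(0,1)², c x₀^a x₁^b/(1 − x₀²x₁²)]`
and the triangle representation `R = [T, c z₀^{a−b−1} z₁^b/(1 − z₁²)]`,
`T = {0 < z₀ < 1, 0 ≤ z₁ ≤ z₀}`, differ by a relation: `N` is congruent (rule 1, two null edges)
to the same integrand on the band-box `{0 < x₀ < 1, 0 ≤ x₁ ≤ 1}`, which the substitution
`z₁ = x₀x₁` along the last coordinate (`KZ.of_sub_of_mem_relations_of_affine`, `α = 0`, `β = x₀`,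
Jacobian `x₀`) carries onto `T` with
`c x₀^{a−b−1}(x₀x₁)^b/(1 − (x₀x₁)²) · x₀ = c x₀^a x₁^b/(1 − x₀²x₁²)`. Port of
`…PiBox.AlgLevelOne.alg_merge_box_sub_triangle`. [cite: KontsevichZagier2001, §1.2 rules (1), (2)] -/
theorem lt2_merge_box_sub_triangle (a b : ℕ) (c : ℝ) (hc : IsAlgebraic ℚ c) (hab : b < a)
    (N R : IntegralRep 2)
    (hNd : N.domain = {x | ∀ i, x i ∈ Set.Ioo (0:ℝ) 1})
    (hNi : EqOn N.integrand (fun x => c * (x 0 ^ a * x 1 ^ b) / (1 - x 0 ^ 2 * x 1 ^ 2)) N.domain)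
    (hRd : R.domain = KZlog.band {y : Fin 1 → ℝ | 0 < y 0 ∧ y 0 < 1} (fun _ => (0:ℝ)) (fun y => y 0))
    (hRi : EqOn R.integrand (fun z => c * (z 0 ^ (a - b - 1) * z 1 ^ b) / (1 - z 1 ^ 2)) R.domain) :
    of N - of R ∈ relations := by
  -- the open base `G = (0,1) ⊆ ℝ¹` and the band-box `B₀` over it
  have hG : IsSemialgebraic ℚ {y : Fin 1 → ℝ | 0 < y 0 ∧ y 0 < 1} :=
    isSemialgebraic_unitInterval_fin_one
  have hGo : IsOpen {y : Fin 1 → ℝ | 0 < y 0 ∧ y 0 < 1} :=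
    isOpen_Ioo.preimage (continuous_apply 0)
  have hB : IsSemialgebraic ℚ
      (KZlog.band {y : Fin 1 → ℝ | 0 < y 0 ∧ y 0 < 1} (fun _ => (0:ℝ)) (fun _ => (1:ℝ))) :=
    KZlog.isSemialgebraic_band (by simpa using isSemialgebraicFunOn_ratCast hG 0)
      (by simpa using isSemialgebraicFunOn_ratCast hG 1)
  -- the explicit integrand is semialgebraic on the band-box (its denominator is positive there)
  have hsa : IsSemialgebraicFunOn ℚ
      (KZlog.band {y : Fin 1 → ℝ | 0 < y 0 ∧ y 0 < 1} (fun _ => (0:ℝ)) (fun _ => (1:ℝ)))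
      (fun x => c * (x 0 ^ a * x 1 ^ b) / (1 - x 0 ^ 2 * x 1 ^ 2)) :=
    lt2_isSemialgebraicFunOn_alg_monomial_div a b hc hB
  -- ... and integrable there: the band-box is the open box plus two null edges
  have hNint : IntegrableOn
      (fun x : Fin 2 → ℝ => c * (x 0 ^ a * x 1 ^ b) / (1 - x 0 ^ 2 * x 1 ^ 2))
      N.domain := N.integrableOn.congr_fun hNi (IntegralRep.measurableSet_domain_holds N)
  have hsub : KZlog.band {y : Fin 1 → ℝ | 0 < y 0 ∧ y 0 < 1} (fun _ => (0:ℝ)) (fun _ => (1:ℝ)) ⊆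
      N.domain ∪ ({z | z 1 = 0} ∪ {z | z 1 = 1}) := by
    intro z hz
    have h : (0 < z 0 ∧ z 0 < 1) ∧ 0 ≤ z 1 ∧ z 1 ≤ 1 := hz
    rcases h.2.1.eq_or_lt with h0 | h0
    · exact Or.inr (Or.inl h0.symm)
    rcases h.2.2.lt_or_eq with h1 | h1
    · refine Or.inl ?_
      rw [hNd]
      exact Fin.forall_fin_two.2 ⟨⟨h.1.1, h.1.2⟩, ⟨h0, h1⟩⟩
    · exact Or.inr (Or.inr h1)
  have hint : IntegrableOn
      (fun x : Fin 2 → ℝ => c * (x 0 ^ a * x 1 ^ b) / (1 - x 0 ^ 2 * x 1 ^ 2))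
      (KZlog.band {y : Fin 1 → ℝ | 0 < y 0 ∧ y 0 < 1} (fun _ => (0:ℝ)) (fun _ => (1:ℝ))) :=
    (hNint.union ((IntegrableOn.of_measure_zero
      (Measure.pi_hyperplane (fun _ => (volume : Measure ℝ)) 1 0)).union
      (IntegrableOn.of_measure_zero
        (Measure.pi_hyperplane (fun _ => (volume : Measure ℝ)) 1 1)))).mono_set hsub
  -- the representation `r = [B₀, c x₀^a x₁^b/(1 − x₀²x₁²)]`
  obtain ⟨r, hrd, hri⟩ : ∃ r : IntegralRep 2,
      r.domain = KZlog.band {y : Fin 1 → ℝ | 0 < y 0 ∧ y 0 < 1} (fun _ => (0:ℝ)) (fun _ => (1:ℝ)) ∧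
      r.integrand = fun x => c * (x 0 ^ a * x 1 ^ b) / (1 - x 0 ^ 2 * x 1 ^ 2) :=
    ⟨⟨_, _, hB, hsa, hint⟩, rfl, rfl⟩
  -- (rule 1) `N` versus `r`: restriction to the open box and congruence
  have hEr : N.domain ⊆ r.domain := by
    intro z hz
    rw [hNd] at hz
    have h0 := hz 0
    have h1 := hz 1
    rw [hrd]
    show (0 < z 0 ∧ z 0 < 1) ∧ 0 ≤ z 1 ∧ z 1 ≤ 1
    exact ⟨⟨h0.1, h0.2⟩, h1.1.le, h1.2.le⟩
  have hnull : volume (r.domain \ N.domain) = 0 := by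
    refine measure_mono_null (fun z hz => ?_)
      (measure_union_null (Measure.pi_hyperplane (fun _ => (volume : Measure ℝ)) 1 0)
        (Measure.pi_hyperplane (fun _ => (volume : Measure ℝ)) 1 1))
    rcases hsub (hrd ▸ hz.1) with h | h
    · exact absurd h hz.2
    · exact h
  have e1 : of r - of (r.restrict N.domain N.isSemialgebraic_domain hEr) ∈ relations :=
    r.of_sub_of_restrict_mem_relations N.isSemialgebraic_domain hEr hnull
  have e2 : of N - of (r.restrict N.domain N.isSemialgebraic_domain hEr) ∈ relations :=
    of_sub_of_mem_relations_of_eqOn rfl (by rw [IntegralRep.integrand_restrict, hri]; exact hNi)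
  -- (rule 2) `r` versus `R`: the substitution `z₁ = x₀ x₁` along the last coordinate
  have key : ∀ z ∈ r.domain, r.integrand z =
      R.integrand (Fin.snoc (Fin.init z) (0 + Fin.init z 0 * z (Fin.last 1))) * Fin.init z 0 := by
    intro z hz
    rw [hrd] at hz
    obtain ⟨hzG, h0, h1⟩ := KZlog.mem_band.1 hz
    have hx : 0 < Fin.init z 0 ∧ Fin.init z 0 < 1 := hzG
    have h0' : 0 ≤ z (Fin.last 1) := h0
    have h1' : z (Fin.last 1) ≤ 1 := h1
    have hw : (Fin.snoc (Fin.init z) (0 + Fin.init z 0 * z (Fin.last 1)) : Fin 2 → ℝ) ∈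
        R.domain := by
      rw [hRd]
      refine KZlog.mem_band.2 ?_
      rw [Fin.init_snoc, Fin.snoc_last]
      exact ⟨hzG, by nlinarith [mul_nonneg hx.1.le h0'],
        by nlinarith [mul_le_mul_of_nonneg_left h1' hx.1.le]⟩
    rw [hRi hw, hri]
    exact lt2_merge_identity_snoc hab c z
  have e3 : of r - of R ∈ relations :=
    of_sub_of_mem_relations_of_affine (m := 1) hGo (α := fun _ => (0:ℝ)) (β := fun y => y 0)
      (a := fun _ => (0:ℝ)) (b := fun _ => (1:ℝ)) (a' := fun _ => (0:ℝ)) (b' := fun y => y 0)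
      (by simpa using isSemialgebraicFunOn_ratCast hG 0) (isSemialgebraicFunOn_apply hG 0)
      (differentiableOn_const 0) (differentiableOn_apply 0 _) (fun y hy => hy.1) r R hrd hRd
      (fun y _ => by ring) (fun y _ => by ring) key
  -- bookkeeping
  have e : of N - of R = (of N - of (r.restrict N.domain N.isSemialgebraic_domain hEr)) -
      (of r - of (r.restrict N.domain N.isSemialgebraic_domain hEr)) + (of r - of R) := by
    abel
  rw [e]
  exact relations.add_mem (relations.sub_mem e2 e1) e3

/-- **Coordinate swap with a real coefficient at level two** (rule 2):
`[(0,1)², c x₀^a x₁^b/(1 − x₀²x₁²)] ≡ [(0,1)², c x₀^b x₁^a/(1 − x₀²x₁²)]`, by reindexing along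
`Equiv.swap 0 1` (`KZ.of_sub_of_reindex_mem_relations`) and congruence of the integrands on the
(swap-invariant) open box; the kernel `1/(1 − x₀²x₁²)` is swap-invariant. Port of
`…PiBox.AlgLevelOne.alg_swap_monomial_sub_mem_relations`.
[cite: KontsevichZagier2001, §1.2 rule (2)] -/
theorem lt2_swap_monomial_sub_mem_relations (a b : ℕ) (c : ℝ) (N N' : IntegralRep 2)
    (hNd : N.domain = {x | ∀ i, x i ∈ Set.Ioo (0:ℝ) 1})
    (hNi : EqOn N.integrand (fun x => c * (x 0 ^ a * x 1 ^ b) / (1 - x 0 ^ 2 * x 1 ^ 2)) N.domain)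
    (hN'd : N'.domain = {x | ∀ i, x i ∈ Set.Ioo (0:ℝ) 1})
    (hN'i : EqOn N'.integrand (fun x => c * (x 0 ^ b * x 1 ^ a) / (1 - x 0 ^ 2 * x 1 ^ 2))
      N'.domain) :
    of N - of N' ∈ relations := by
  have h1 := of_sub_of_reindex_mem_relations N (Equiv.swap (0 : Fin 2) 1)
  have hd : (N.reindex (Equiv.swap (0 : Fin 2) 1)).domain = {x | ∀ i, x i ∈ Set.Ioo (0:ℝ) 1} := by
    ext w
    simp only [IntegralRep.reindex_domain, hNd, mem_setOf_eq, Fin.forall_fin_two,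
      Equiv.swap_apply_left, Equiv.swap_apply_right]
    tauto
  have h2 : of (N.reindex (Equiv.swap (0 : Fin 2) 1)) - of N' ∈ relations := by
    refine of_sub_of_mem_relations_of_eqOn (hN'd.trans hd.symm) fun w hw => ?_
    have hw' : (fun i => w (Equiv.swap (0 : Fin 2) 1 i)) ∈ N.domain := by
      rw [IntegralRep.reindex_domain] at hw
      exact hw
    rw [IntegralRep.reindex_integrand]
    show N.integrand (fun i => w (Equiv.swap (0 : Fin 2) 1 i)) = N'.integrand w
    rw [hNi hw', hN'i (hN'd ▸ hd ▸ hw)]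
    simp only [Equiv.swap_apply_left, Equiv.swap_apply_right]
    ring
  have e : of N - of N' = (of N - of (N.reindex (Equiv.swap (0 : Fin 2) 1))) +
      (of (N.reindex (Equiv.swap (0 : Fin 2) 1)) - of N') := by abel
  rw [e]
  exact relations.add_mem h1 h2

/-- **Stub T1 (merge gadget `u = xy` + swap for the kernel `1/(1 − x²y²)`, rule 2).** For a
real-algebraic coefficient `c` and exponents `a, b`:
(1) if `b < a`, the box representation `[(0,1)², c x₀^a x₁^b/(1 − x₀²x₁²)]` and the triangle
representation `[{0 < z₀ < 1, 0 ≤ z₁ ≤ z₀}, c z₀^{a−b−1} z₁^b/(1 − z₁²)]` differ by a KZ relation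
(null edges, rule 1, then the merge substitution `z₁ = x₀x₁`, rule 2);
(2) the box representations with integrands `c x₀^a x₁^b/(1 − x₀²x₁²)` and
`c x₀^b x₁^a/(1 − x₀²x₁²)` differ by a KZ relation (the coordinate swap, rule 2).
[cite: KontsevichZagier2001, §1.2 rules (1), (2)] -/
theorem levelTwo_merge_and_swap (a b : ℕ) (c : ℝ) (hc : IsAlgebraic ℚ c) :
    (b < a → ∀ (N R : IntegralRep 2),
      N.domain = {x | ∀ i, x i ∈ Set.Ioo (0:ℝ) 1} →
      EqOn N.integrand (fun x => c * (x 0 ^ a * x 1 ^ b) / (1 - x 0 ^ 2 * x 1 ^ 2)) N.domain →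
      R.domain = KZlog.band {y : Fin 1 → ℝ | 0 < y 0 ∧ y 0 < 1} (fun _ => (0:ℝ)) (fun y => y 0) →
      EqOn R.integrand (fun z => c * (z 0 ^ (a - b - 1) * z 1 ^ b) / (1 - z 1 ^ 2)) R.domain →
      of N - of R ∈ relations) ∧
    (∀ (N N' : IntegralRep 2),
      N.domain = {x | ∀ i, x i ∈ Set.Ioo (0:ℝ) 1} →
      EqOn N.integrand (fun x => c * (x 0 ^ a * x 1 ^ b) / (1 - x 0 ^ 2 * x 1 ^ 2)) N.domain →
      N'.domain = {x | ∀ i, x i ∈ Set.Ioo (0:ℝ) 1} →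
      EqOn N'.integrand (fun x => c * (x 0 ^ b * x 1 ^ a) / (1 - x 0 ^ 2 * x 1 ^ 2)) N'.domain →
      of N - of N' ∈ relations) := by
  exact ⟨fun hab N R hNd hNi hRd hRi => lt2_merge_box_sub_triangle a b c hc hab N R hNd hNi hRd hRi,
    fun N N' hNd hNi hN'd hN'i => lt2_swap_monomial_sub_mem_relations a b c N N' hNd hNi hN'd hN'i⟩

end Summit.KontsevichZagierPeriods.HurwitzMicroSectors.NormalFormPrinciple.PiBox.AlgLevelTwo
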